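import Literature.IUT.LogThetaLattice.LogShellContainersGenuine
import HarnessLib

/-!
# Genuine log-shell containers of TWO local fields: every isometric bicontinuous additive isomorphism `k ≃ k'` is a
# morphism `(k, 𝒪_k) ⟶ (k', 𝒪_{k'})`, and [IUTchIII] Prop 3.9 (ii) holds along the poly-isomorphism of all of them

Sequel (abc-iut cell, seat abc-iut-w4-d005 gen 4, NV row «LOGSHELL-READING-GENUINE», part 2) of
`LogShellContainersGenuine.lean` (p432199). S. Mochizuki, *Inter-universal Teichmüller Theory III*, kurims manuscript (May
2020), Prop. 1.2 (vi) p. 32 («isomorphisms of topological modules … compatible with the log-shells»), Prop. 3.2 (i) p. 93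
(the natural poly-isomorphisms between the local data at `v` of isomorphic prime-strips), Prop. 3.9 (ii) p. 116
[claim key Mochizuki2012, status disputed (D-0012)]; *Topics in Absolute Anabelian Geometry III*, Prop. 5.7 (i)(b) p. 138
(«if `x ∈ 𝒪_k^×`, then `μ^log_k(x·A) = μ^log_k(A)`»; isometries preserve `𝒪_k`) [cite: MochizukiAbsTopIII2015, Prop. 5.7 (i) p. 137].

WHAT THIS FILE ADDS (two small definitions = morphism constructors, everything else proved):
* `homOfNormPreserving φ hφ : ofLocalField k ⟶ ofLocalField k'` — an ISOMETRIC bicontinuous additive isomorphism between two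
  nonarchimedean local fields (e.g. the additive map of a continuous isomorphism of valued fields `k ≃ k'`, which is how an
  isomorphism of `𝒟^⊢`- or `𝓕`-prime-strips acts on the local data at `v`) carries `𝒪_k` onto `𝒪_{k'}`, hence IS a morphism of genuine
  log-shell containers; `homOfNormPreserving_refl`, `homOfNormPreserving_trans` (functoriality), `homOfNormPreserving_symm`;
* `isometricPoly k k'` — the poly-isomorphism of ALL isometric isomorphisms `(k, 𝒪_k) ⥲ (k', 𝒪_{k'})` — and
  **`prop39ii_isometricPoly`**: abc-iut-L6-t4's `Prop39ii_monoAnalyticCompat` holds along it with the normalised log-volumes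
  `μ^log_k`, `μ^log_{k'}` (ZERO hypotheses), **`localLogVolume_eq_of_normPreserving`**: `μ^log_{k'}(φ(T)) = μ^log_k(T)` — the
  container-level content of Prop 3.9 (ii) «compatible with the log-volumes …, relative to the natural poly-isomorphisms of
  Proposition 3.2, (i)» between the local data of two isomorphic strips, read genuinely;
* `isometricPoly_nonempty_of` — non-vacuity from any given isometry (e.g. `k' = k`, identity / negation of part 1).

HONEST SCOPE: container level; which isomorphisms the [IUTchII] prime-strip categories actually induce on the local fields is the
kits' data BY NAME. Nothing here takes a side on [IUTchIII] Cor. 3.12; typed ≠ endorsed; what is proved is Haar transport.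
-/

noncomputable section

namespace Literature.IUT.LogThetaLattice

namespace LogShellContainer

open CategoryTheory Set Metric
open Literature.IUT.HodgeTheaters Literature.IUT.LogVolume

universe u

section TwoFields

variable (K K' K'' : Type u) [NontriviallyNormedField K] [NontriviallyNormedField K'] [NontriviallyNormedField K'']

/-- An isometric additive bijection between normed fields maps the closed unit ball ONTO the closed unit ball.
[cite: MochizukiAbsTopIII2015, Prop. 5.7 (i) p. 137] -/
private theorem image_closedBall_eq_of_isometric (φ : K ≃ₜ+ K') (hφ : ∀ x, ‖φ x‖ = ‖x‖) :
    φ '' closedBall (0 : K) 1 = closedBall (0 : K') 1 := by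
  ext y
  simp only [mem_image, mem_closedBall, dist_zero_right]
  constructor
  · rintro ⟨x, hx, rfl⟩
    rwa [hφ]
  · intro hy
    exact ⟨φ.symm y, by rw [← hφ, ContinuousAddEquiv.apply_symm_apply]; exact hy,
      ContinuousAddEquiv.apply_symm_apply φ y⟩

variable [IsUltrametricDist K] [ProperSpace K] [IsUltrametricDist K'] [ProperSpace K']
  [IsUltrametricDist K''] [ProperSpace K'']

/-- **IUTchIII:Prop1.2(vi)** (kurims p.32) / [AbsTopIII] Prop 5.7 (i): an ISOMETRIC bicontinuous additive isomorphism
`k ≃ k'` of nonarchimedean local fields carries `𝒪_k` onto `𝒪_{k'}` and is therefore a morphism of genuine log-shell containers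
`(k, 𝒪_k) ⟶ (k', 𝒪_{k'})`. [claim: Mochizuki2012, status: disputed] -/
def homOfNormPreserving (φ : K ≃ₜ+ K') (hφ : ∀ x, ‖φ x‖ = ‖x‖) : ofLocalField K ⟶ ofLocalField K' :=
  ⟨φ, image_closedBall_eq_of_isometric K K' φ hφ⟩

/-- The underlying isomorphism of `homOfNormPreserving`. [claim: Mochizuki2012, status: disputed] -/
@[simp] theorem homOfNormPreserving_iso (φ : K ≃ₜ+ K') (hφ : ∀ x, ‖φ x‖ = ‖x‖) :
    (homOfNormPreserving K K' φ hφ).iso = φ := rfl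

/-- Functoriality: the identity isometry gives the identity morphism. [claim: Mochizuki2012, status: disputed] -/
theorem homOfNormPreserving_refl :
    homOfNormPreserving K K (ContinuousAddEquiv.refl K) (fun _ => rfl) = 𝟙 (ofLocalField K) := rfl

/-- Functoriality: composition of isometries gives composition of morphisms. [claim: Mochizuki2012, status: disputed] -/
theorem homOfNormPreserving_trans (φ : K ≃ₜ+ K') (hφ : ∀ x, ‖φ x‖ = ‖x‖) (ψ : K' ≃ₜ+ K'')
    (hψ : ∀ y, ‖ψ y‖ = ‖y‖) :
    homOfNormPreserving K K'' (φ.trans ψ) (fun x => by rw [ContinuousAddEquiv.trans_apply, hψ, hφ]) =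
      homOfNormPreserving K K' φ hφ ≫ homOfNormPreserving K' K'' ψ hψ := rfl

/-- The inverse isometry gives the inverse morphism (`Hom.symm` of part 1). [claim: Mochizuki2012, status: disputed] -/
theorem homOfNormPreserving_symm (φ : K ≃ₜ+ K') (hφ : ∀ x, ‖φ x‖ = ‖x‖) :
    Hom.symm (homOfNormPreserving K K' φ hφ) =
      homOfNormPreserving K' K φ.symm (fun y => by
        conv_rhs => rw [← ContinuousAddEquiv.apply_symm_apply φ y]
        rw [hφ]) := by
  apply Hom.ext; rfl

/-- **IUTchIII:Prop3.9(ii)** (kurims p.116) at two local fields, genuinely: along every isometric isomorphism the normalised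
log-volume is transported, `μ^log_{Λ_{k'}}(φ(T)) = μ^log_{Λ_k}(T)` (campaign-S Haar transport BY NAME through part 1's
`logVolume_image_hom`). [claim: Mochizuki2012, status: disputed] -/
theorem localLogVolume_eq_of_normPreserving (φ : K ≃ₜ+ K') (hφ : ∀ x, ‖φ x‖ = ‖x‖) (T : Set K) :
    (ofLocalField K').Λ.logVolume (φ '' T) = (ofLocalField K).Λ.logVolume T :=
  logVolume_image_hom (homOfNormPreserving K K' φ hφ) T

/-- **IUTchIII:Prop3.2(i)** (kurims p.93) read at the containers: the poly-isomorphism of ALL isometric bicontinuous additive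
isomorphisms `(k, 𝒪_k) ⥲ (k', 𝒪_{k'})` (the container-level shadow of "the natural poly-isomorphisms" between the local data at
`v` of isomorphic prime-strips): the isomorphisms of the form `homOfNormPreserving φ hφ`. [claim: Mochizuki2012, status: disputed] -/
def isometricPoly : PolyIso (ofLocalField K) (ofLocalField K') :=
  Set.range fun φh : {φ : K ≃ₜ+ K' // ∀ x, ‖φ x‖ = ‖x‖} => isoOfHom (homOfNormPreserving K K' φh.1 φh.2)

/-- Membership in `isometricPoly`: being induced by an isometry. [claim: Mochizuki2012, status: disputed] -/
theorem mem_isometricPoly_iff (e : ofLocalField K ≅ ofLocalField K') :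
    e ∈ isometricPoly K K' ↔ ∃ (φ : K ≃ₜ+ K') (hφ : ∀ x, ‖φ x‖ = ‖x‖), isoOfHom (homOfNormPreserving K K' φ hφ) = e :=
  ⟨fun ⟨φh, h⟩ => ⟨φh.1, φh.2, h⟩, fun ⟨φ, hφ, h⟩ => ⟨⟨φ, hφ⟩, h⟩⟩

/-- Every isometry supplies a member of `isometricPoly` (non-vacuity from data). [claim: Mochizuki2012, status: disputed] -/
theorem isoOfHom_homOfNormPreserving_mem (φ : K ≃ₜ+ K') (hφ : ∀ x, ‖φ x‖ = ‖x‖) :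
    isoOfHom (homOfNormPreserving K K' φ hφ) ∈ isometricPoly K K' := ⟨⟨φ, hφ⟩, rfl⟩

/-- `isometricPoly k k'` is nonempty as soon as one isometry `k ≃ k'` is given. [claim: Mochizuki2012, status: disputed] -/
theorem isometricPoly_nonempty_of (φ : K ≃ₜ+ K') (hφ : ∀ x, ‖φ x‖ = ‖x‖) : (isometricPoly K K').Nonempty :=
  ⟨_, isoOfHom_homOfNormPreserving_mem K K' φ hφ⟩

/-- The underlying map of a member of `isometricPoly` is an isometry `k → k'`. [claim: Mochizuki2012, status: disputed] -/
theorem norm_map_of_mem_isometricPoly {e : ofLocalField K ≅ ofLocalField K'} (he : e ∈ isometricPoly K K') :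
    ∃ φ : K ≃ₜ+ K', (∀ x, ‖φ x‖ = ‖x‖) ∧ (⇑φ : K → K') = (forget.mapIso e).hom := by
  obtain ⟨⟨φ, hφ⟩, rfl⟩ := he
  exact ⟨φ, hφ, rfl⟩

/-- **IUTchIII:Prop3.9(ii)** (kurims p.116) **between two local fields, genuine form, ZERO hypotheses**: abc-iut-L6-t4's
`Prop39ii_monoAnalyticCompat` holds for the reading of the poly-isomorphism of all isometric isomorphisms `(k, 𝒪_k) ⥲ (k', 𝒪_{k'})`,
with the normalised log-volumes `μ^log_k`, `μ^log_{k'}` — a special case of part 1's `prop39ii_genuine`.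
[claim: Mochizuki2012, status: disputed] -/
theorem prop39ii_isometricPoly :
    Prop39ii_monoAnalyticCompat
      ((fun e : ofLocalField K ≅ ofLocalField K' => (forget.mapIso e).toEquiv) '' isometricPoly K K')
      (ofLocalField K).Λ.logVolume (ofLocalField K').Λ.logVolume :=
  prop39ii_genuine (isometricPoly K K')

end TwoFields

section OneField

variable (K : Type u) [NontriviallyNormedField K] [IsUltrametricDist K] [ProperSpace K]

/-- `isometricPoly k k` is never empty: it contains the identity … [claim: Mochizuki2012, status: disputed] -/
theorem refl_mem_isometricPoly : Iso.refl (ofLocalField K) ∈ isometricPoly K K :=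
  ⟨⟨ContinuousAddEquiv.refl K, fun _ => rfl⟩, Iso.ext rfl⟩

/-- … and the negation automorphism of part 1 (`negIso`, `‖−x‖ = ‖x‖`). [claim: Mochizuki2012, status: disputed] -/
theorem negIso_mem_isometricPoly : isoOfHom (negIso K) ∈ isometricPoly K K :=
  ⟨⟨negEquiv K, fun x => by rw [negEquiv_apply, norm_neg]⟩, Iso.ext rfl⟩

/-- Hence `isometricPoly k k` has at least two members in characteristic `≠ 2` (identity ≠ negation, part 1 `negIso_ne_id`).
[claim: Mochizuki2012, status: disputed] -/
theorem isometricPoly_two_members (h2 : (2 : K) ≠ 0) :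
    ∃ e ∈ isometricPoly K K, ∃ e' ∈ isometricPoly K K, e ≠ e' :=
  ⟨isoOfHom (negIso K), negIso_mem_isometricPoly K, Iso.refl _, refl_mem_isometricPoly K, fun h =>
    negIso_ne_id K h2 (by simpa using congrArg Iso.hom h)⟩

end OneField

end LogShellContainer

end Literature.IUT.LogThetaLattice

end
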